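import Summits.ResolutionOfSingularities.ResolutionOfSingularities.Theorems.FrobeniusClosingPatchingRelPerfectDepthBetaTwoCompositionOne
import Summits.ResolutionOfSingularities.ResolutionOfSingularities.Theorems.FrobeniusClosingPatchingRelPerfectDepthPhaseCAtlasP
import Summits.ResolutionOfSingularities.ResolutionOfSingularities.Theorems.FrobeniusClosingPatchingRelPerfectDepthMultiHostInitialHolds
import Summits.ResolutionOfSingularities.ResolutionOfSingularities.Theorems.FrobeniusClosingPatchingRelPerfectDepthFormatEndOnCylHolds
import Summits.ResolutionOfSingularities.ResolutionOfSingularities.Theorems.FrobeniusClosingPatchingRelPerfectDepthMultiHostCJSTransportLift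
import HarnessLib

/-!
# Crux `PatchingRelPerfect` (stmt-ResolutionOfSingularities-16161), chain W5.2 — F7(β) (β-AX) d = 2:
# THE BY-NAME REDUCTION of the member class to ⟨F-32bR⟩ and the ONE open Prop `PhaseCOne CylReach`

[OURS · L1 W5.2 · F7(β) (β-AX) (res-L1-w52-plan-1 g12 NAMING G12-31)] Fact-free and def-free composition; NOT statements of the manuscript
under review (Hironaka 2017); AI-written, weaker than expert review.  **F7(β) d = 2 member class: CORE by name modulo ⟨F-32bR⟩
(`CossartJannsenSaito2020EmbeddedSequenceB`, a published theorem typed as a named fact) and the ONE open Prop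
`ChainW52F7BetaRP.PhaseCOne ChainW52F7BetaRP.CylReach` (C-I, res-L1-w52-lead-1 assembly).**

* `initialMultiHost₂_holds` — T0 `InitialMultiHost₂` (targets v7) from res-D-pv-055΄s `DepthMultiHost.initialMultiHost₂` (p559318).
* `betaTwoAtomConclusion₂_of_phaseCOne_cylReach` — **the (β) d = 2 atom conclusion from `CossartJannsenSaito2020EmbeddedSequenceB` and
  `PhaseCOne CylReach`**: res-D-pv-021΄s T5-over-`PhaseCOne` `betaTwo_atomConclusion_of_phaseCOne` (p560170) fed with T0 (above), T2
  (res-D-pv-054 `MultiHostCJS.cjsTransport₂_holds`, p565385), T2c (res-D-pv-021΄s `ChainW52F7Beta.formatEndOnCyl₂_holds`,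
  δ-identical text) and the atlas ⟨`CylReach`, `stepStable_cylReach`,
  `atlasInitial_cylReach`, `PhaseCOne CylReach`⟩ (res-L1-w52-lead-1, p560708).  Stated with the body of `BetaTwoAtomConclusion₂` unfolded
  (binders explicit), the folded form recorded as an `example`.

## References
* V. Cossart, U. Jannsen, S. Saito, LNM 2270 (2020), Thm. 1.4, (6.2). [CossartJannsenSaito2020]
* J. Kollár, *Lectures on Resolution of Singularities* (2007), (3.111) Steps 1–3. [Kollar2007]
* H. Hironaka, *Three key theorems on infinitely near singularities* (2005), Lemma 10.3. [Hironaka2005]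
-/

-- `Summit.<Summit>.<Sub>.Theorems` with `Sub = Summit` (single-conjunct summit, D-0017)
set_option linter.dupNamespace false

noncomputable section

open CategoryTheory CategoryTheory.Limits AlgebraicGeometry TopologicalSpace IsLocalRing
open Literature.AlgebraicGeometry.Resolution Scheme.IdealSheafData

namespace Summit.ResolutionOfSingularities.ResolutionOfSingularities.Theorems

universe u

namespace ChainW52F7BetaRP

open DepthMultiHost

/-- [OURS · L1 W5.2 · F7(β) (β-AX) T0] **`InitialMultiHost₂` holds** (targets v7; res-D-pv-055΄s `DepthMultiHost.initialMultiHost₂`, binders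
verbatim). [cite: Kollar2007, (3.111) Steps 1–3] -/
theorem initialMultiHost₂_holds : InitialMultiHost₂.{u} :=
  fun S _ _ _ hdim κ₀ _ σ hσ x hx s P hP hP0 => DepthMultiHost.initialMultiHost₂ S hdim κ₀ σ hσ x hx s P hP hP0

/-- [OURS · L1 W5.2 · F7(β) (β-AX)] **THE (β) d = 2 ATOM CONCLUSION from the named fact F-32bR and the one open Prop `PhaseCOne CylReach`**
(= `BetaTwoAtomConclusion₂` unfolded): every graded member ideal of degree profile (2, 2) in a complete regular local fourfold with a
perfect-type coefficient field is principalised, above its affine blowing up, by ONE blowing up along a centre supported over the closed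
point with regular top.  CORE by name modulo ⟨`CossartJannsenSaito2020EmbeddedSequenceB`, `PhaseCOne CylReach`⟩; nothing is attributed
to the manuscript under review. [cite: CossartJannsenSaito2020, Thm. 1.4, (6.2)] [cite: Kollar2007, (3.111) Steps 1–3] -/
theorem betaTwoAtomConclusion₂_of_phaseCOne_cylReach (hCJS : CossartJannsenSaito2020EmbeddedSequenceB.{u})
    (hC : PhaseCOne CylReach.{u})
    (S : Type u) [CommRing S] [IsRegularLocalRing S] [IsAdicComplete (IsLocalRing.maximalIdeal S) S]
    (hdim : ringKrullDim S = (4 : ℕ))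
    (κ₀ : Type u) [Field κ₀] (σ : κ₀ →+* S) (hσ : Function.Bijective ⇑((IsLocalRing.residue S).comp σ))
    (x : Fin 4 → S) (hx : Ideal.span (Set.range x) = IsLocalRing.maximalIdeal S)
    (s : ℕ) (P : Fin s → MvPolynomial (Fin 4) κ₀) (hP : ∀ j, P j ∈ MvPolynomial.homogeneousSubmodule (Fin 4) κ₀ 2)
    (hI : DepthTargets.gradedMemberIdeal σ x 2 2 P ≠ ⊥)
    (T : Scheme.{u}) (f : T ⟶ Spec (.of S)) (hf : IsBlowup f (affineBlowup.idealSheaf (DepthTargets.gradedMemberIdeal σ x 2 2 P))) :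
    ∃ (J : T.IdealSheafData) (T' : Scheme.{u}) (π : T' ⟶ T), J ≠ ⊥ ∧
      (∀ t : T, t ∈ J.support → f.base t = IsLocalRing.closedPoint S) ∧
      IsBlowup π J ∧ Scheme.IsRegular T' :=
  betaTwo_atomConclusion_of_phaseCOne initialMultiHost₂_holds (MultiHostCJS.cjsTransport₂_holds hCJS) ChainW52F7Beta.formatEndOnCyl₂_holds
    (exists_atlasOne_of_phaseCOne_cylReach hC) S hdim κ₀ σ hσ x hx s P hP hI T f hf

/-- Folded: `BetaTwoAtomConclusion₂` modulo ⟨F-32bR, `PhaseCOne CylReach`⟩ (a `δ`-step, kept as documentation). -/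
example (hCJS : CossartJannsenSaito2020EmbeddedSequenceB.{u}) (hC : PhaseCOne CylReach.{u}) : BetaTwoAtomConclusion₂.{u} :=
  betaTwoAtomConclusion₂_of_phaseCOne_cylReach hCJS hC

end ChainW52F7BetaRP

end Summit.ResolutionOfSingularities.ResolutionOfSingularities.Theorems

end
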